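import Literature.AlgebraicGeometry.Hu2025.Statements.S04ModelV.R104bEquationsOfV
import HarnessLib

/-!
# Hu 2025 (arXiv:2507.21400v1), §4.4 Prop. 4.44 ‹chunk Proposition 4.43› (chunk p0030 l.50–65; PDF p.70) — OURS reading sibling with
# multi-homogeneous terms in `R_{[k]}` (PARTITION-HU row 104, file c; additive to `R104bEquationsOfV` p516840; typer res-type-044)

**Status of the source (D-0012): UNREFEREED PREPRINT UNDER ADJUDICATION.** Nothing from the preprint is asserted: the declaration below
is a `def … : Prop` CANDIDATE `[claim: Hu2025, status: under-review]`, an OURS READING filed next to the as-printed `Prop4_44` of file b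
(unchanged) in answer to the lane-B note res-ref-b12 N104b-1 (HOME/STATUS.md 2026-08-27T09:15:04Z, «OWNER, no bounce»): the (4.31)-datum
`Eq4_31Datum` leaves the terms `f_s` free («`φ(f_s) = h x̄_s` for some `h`», chunk p0029 l.60–72), as printed, so `Prop4_44` quantifies
also over term families that are not multi-homogeneous elements of `R_{[k]}`; the printed proof («This follows directly from (4.32)»,
chunk p0030 l.62–65) and the phrase «following the notation above» (l.55) read the `f_s` as multi-homogeneous polynomials of `R_{[k]}`
(chunk p0029 l.58–59 «Let `f ∈ R_{[k]}` be any multi-homogenous polynomial …»). The sibling adds exactly these two hypotheses on the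
terms; no side is taken between the two readings (the lanes / the M-Hu leads choose). No proofs, no `sorry`, no `instance`, no notation.
HONEST CEILING (PARTITION-HU header) applies; AI typing is weaker than expert review.
-/

noncomputable section

namespace Literature.AlgebraicGeometry.Hu2025.Statements.S04ModelV

open MvPolynomial

section Prop444Readings

universe u v w x

variable {k : Type u} [CommRing k] {σ : Type v} {T : Type w} {𝔗 : Type x}
variable (rel : T → 𝔗) (mono : T → (σ →₀ ℕ)) (sgn : T → ℤ)

/-- **Hu 2025, Prop. 4.44 ‹chunk Proposition 4.43› — OURS READING with multi-homogeneous terms** (chunk p0030 l.50–65; PDF p.70;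
with the standing sentence of (4.31), chunk p0029 l.58–59 «Let `f ∈ R_{[k]}` be any multi-homogenous polynomial such that
`φ_{[k]}(f) = h F̄`»), verbatim claim: «… following the notation above, we have `x_{(u_t,v_t)} f_s − x_{(u_s,v_s)} f_t ∈ ker^{mh} φ_{[k]}`
for all `s, t ∈ S_F`.» — as file b's `Prop4_44`, for every (4.31)-datum `D` that is a ϖϱ-Plücker relation (reading R1, `Def4_42`)
AND whose terms `f_s`, `s ∈ S_F`, lie in `R_Φ` (`RSub`) and are multi-homogeneous (`IsMultiHomogeneous`) — the reading of «the
notation above» under which the printed one-line proof from (4.32) applies (lane-B note res-ref-b12 N104b-1, 2026-08-27T09:15:04Z: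
without these two hypotheses the as-printed `Prop4_44` admits term families outside `ker^{mh}`'s ambient conditions). OURS sibling;
`Prop4_44` stays as printed. [claim: Hu2025, status: under-review]
STATUS: candidate statement under adjudication (D-0012/D-0089); not asserted. -/
def Prop4_44_ours [Fintype T] [DecidableEq 𝔗] (Φ : Set 𝔗) : Prop :=
  ∀ D : Eq4_31Datum (k := k) rel mono sgn Φ, Def4_42 (k := k) rel mono sgn D →
    (∀ t : T, rel t = D.F → D.fs t ∈ RSub (k := k) rel Φ ∧ IsMultiHomogeneous (k := k) (σ := σ) rel (D.fs t)) →
      ∀ s t : T, rel s = D.F → rel t = D.F →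
        rhoVar (k := k) (σ := σ) t * D.fs s - rhoVar (k := k) (σ := σ) s * D.fs t ∈ kerMH (k := k) rel mono Φ

end Prop444Readings

/-! ## APPEND (rev 2): the (4.31)/(4.32) datum WITH the presupposed hypotheses on the terms — OURS siblings at the datum level
(lane-A res-ref-a10 BOUNCED/PARTIAL rows on p516840, HOME/STATUS.md 2026-08-27T09:21:54Z, «FIX (typer's call): add to Eq4_31Datum the
fields fs_mem … and fs_mh …; the four dependants then re-sign»; lane B res-ref-b12 09:15:04Z signed the as-printed decls YES with the same
observation as a NIT). The as-printed `Eq4_31Datum` / `Def4_42` / `Def4_42_R2` / `varpiRhoRels` / `Prop4_44` of file b stay unchanged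
(accepted decls are never edited); the siblings below carry the two clauses. No side is taken between the readings. -/

section Eq431Ours

universe u' v' w' x'

variable {k : Type u'} [CommRing k] {σ : Type v'} {T : Type w'} {𝔗 : Type x'}

/-- **Hu 2025, the expression (4.31)/(4.32) — OURS datum with multi-homogeneous terms in `R_{[k]}`** (chunk p0029 l.58–72; PDF p.67:
«Let `f ∈ R_{[k]}` be any multi-homogenous polynomial such that `φ_{[k]}(f) = h F̄` … we express `f = Σ_{s ∈ S_F} sgn(s) f_s` (4.31) such
that `φ_{[k]}(f_s) = h x_{u_s} x_{v_s}` for all `s ∈ S_F` (4.32)»): file b's `Eq4_31Datum` EXTENDED by the two hypotheses the notation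
`φ_{[k]}(f_s)` and Def. 4.42's «the terms of `f`» presuppose (lane A res-ref-a10 09:21:54Z; lane B res-ref-b12 N104b-1): every term `f_s`,
`s ∈ S_F`, lies in `R_Φ` (`RSub`, the printed `R_{[k]}`) and is multi-homogeneous (`IsMultiHomogeneous`). OURS sibling (reading); the
as-printed datum is unchanged. [claim: Hu2025, status: under-review]
STATUS: candidate statement under adjudication (D-0012/D-0089); not asserted. -/
structure Eq4_31Datum_ours [Fintype T] [DecidableEq 𝔗] (rel : T → 𝔗) (mono : T → (σ →₀ ℕ)) (sgn : T → ℤ)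
    (Φ : Set 𝔗) extends Eq4_31Datum (k := k) rel mono sgn Φ where
  /-- every term `f_s`, `s ∈ S_F`, lies in `R_{[k]}` (the domain of `φ_{[k]}` in (4.32)). -/
  fs_mem : ∀ t : T, rel t = F → fs t ∈ RSub (k := k) rel Φ
  /-- every term `f_s`, `s ∈ S_F`, is multi-homogeneous («the terms of `f`», `f` multi-homogeneous). -/
  fs_mh : ∀ t : T, rel t = F → IsMultiHomogeneous (k := k) (σ := σ) rel (fs t)

variable (rel : T → 𝔗) (mono : T → (σ →₀ ℕ)) (sgn : T → ℤ)

/-- **Hu 2025, Def. 4.42 ‹4.41›, ϖϱ-Plücker relation — reading R1 over the OURS datum** (chunk p0030 l.28–33; PDF p.69): file b's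
`Def4_42` evaluated on the underlying as-printed datum of an `Eq4_31Datum_ours`. OURS sibling. [claim: Hu2025, status: under-review]
STATUS: candidate statement under adjudication (D-0012/D-0089); not asserted. -/
def Def4_42_ours [Fintype T] [DecidableEq 𝔗] {Φ : Set 𝔗} (D : Eq4_31Datum_ours (k := k) rel mono sgn Φ) : Prop :=
  Def4_42 (k := k) rel mono sgn D.toEq4_31Datum

/-- **Hu 2025, Def. 4.42 ‹4.41› — reading R2 («co-prime, modulo `ker^{mh} φ_{[k]}`») over the OURS datum** (chunk p0030 l.31–32;
PDF p.69): file b's `Def4_42_R2` on the underlying datum. OURS sibling. [claim: Hu2025, status: under-review]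
STATUS: candidate statement under adjudication (D-0012/D-0089); not asserted. -/
def Def4_42_R2_ours [Fintype T] [DecidableEq 𝔗] {Φ : Set 𝔗} (D : Eq4_31Datum_ours (k := k) rel mono sgn Φ) : Prop :=
  Def4_42_R2 (k := k) rel mono sgn D.toEq4_31Datum

/-- **Hu 2025, Def. 4.42, the set `𝓕^{ϖϱ}_{[k]}` — over the OURS datum** (chunk p0030 l.35–36; PDF p.69): the `f` of the OURS
(4.31)-data (terms in `R_{[k]}`, multi-homogeneous) satisfying `Def4_42`. OURS sibling of file b's `varpiRhoRels` (which ranges over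
the as-printed data). [claim: Hu2025, status: under-review]
STATUS: candidate statement under adjudication (D-0012/D-0089); not asserted. -/
def varpiRhoRels_ours [Fintype T] [DecidableEq 𝔗] (Φ : Set 𝔗) : Set (ModelRing σ T k) :=
  {f | ∃ D : Eq4_31Datum_ours (k := k) rel mono sgn Φ, D.f = f ∧ Def4_42 (k := k) rel mono sgn D.toEq4_31Datum}

/-- **Hu 2025, Prop. 4.44 ‹4.43› — DATUM FORM of the OURS reading** (chunk p0030 l.50–65; PDF p.70): the printed claim
`x_{(u_t,v_t)} f_s − x_{(u_s,v_s)} f_t ∈ ker^{mh} φ_{[k]}` for every OURS (4.31)-datum that is a ϖϱ-Plücker relation (reading R1).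
Same content as `Prop4_44_ours` above (which states the two clauses as hypotheses on an as-printed datum); both kept so the lanes can
sign either shape. OURS sibling; file b's `Prop4_44` unchanged. [claim: Hu2025, status: under-review]
STATUS: candidate statement under adjudication (D-0012/D-0089); not asserted. -/
def Prop4_44_oursD [Fintype T] [DecidableEq 𝔗] (Φ : Set 𝔗) : Prop :=
  ∀ D : Eq4_31Datum_ours (k := k) rel mono sgn Φ, Def4_42 (k := k) rel mono sgn D.toEq4_31Datum →
    ∀ s t : T, rel s = D.F → rel t = D.F →
      rhoVar (k := k) (σ := σ) t * D.fs s - rhoVar (k := k) (σ := σ) s * D.fs t ∈ kerMH (k := k) rel mono Φ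

end Eq431Ours

/-! ## APPEND (rev 3): the TERMS-OF-`f` reading of (4.31) — the `f_s` are sub-sums of the monomials of `f`
(lane-A res-ref-a10 FILE-SIGNED/BOUNCED rows on this file, HOME/STATUS.md 2026-08-27T09:34:44Z, CORRECTING its own 09:21:54Z fix: «fs_mem/fs_mh
exclude the junk family of file b but do not make the f_s "the terms of f as in the expression of (4.31)" (chunk p0030 l.30–31; p0029
l.63–67) — sub-sums of the monomials of the multi-homogeneous f … FIX (typer's call): ONE clause fs_terms : ∀ t, rel t = F →
(fs t).support ⊆ f.support»; hand-checked instance there: terms of block-degrees 1, 2, 2 pass fs_mem/fs_mh and fail the printed claim).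
The rev-1/rev-2 siblings stay (lane B signed them 6/6 YES-as-OURS-sibling 09:34:46Z); this section adds the tighter reading. No side taken. -/

section Eq431Terms

universe u'' v'' w'' x''

variable {k : Type u''} [CommRing k] {σ : Type v''} {T : Type w''} {𝔗 : Type x''}

/-- **Hu 2025, the expression (4.31)/(4.32) — TERMS-OF-`f` datum** (chunk p0029 l.58–72; PDF p.67 «we express `f = Σ_{s ∈ S_F} sgn(s) f_s`
(4.31) such that `φ_{[k]}(f_s) = h x_{u_s} x_{v_s}` for all `s ∈ S_F` (4.32)»; Def. 4.42 «all the terms of `f` as in the expression of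
(4.31)», chunk p0030 l.30–31): file b's as-printed `Eq4_31Datum` EXTENDED by ONE clause — every `f_s`, `s ∈ S_F`, is a SUB-SUM OF THE
MONOMIALS OF `f` (`(fs t).support ⊆ f.support`), the reading under which the `f_s` are «the terms of `f`» (it makes each `f_s` an element of
`R_{[k]}` and multi-homogeneous of `f`'s multi-degree, since `f` is). Reading proposed by lane A res-ref-a10 2026-08-27T09:34:44Z (its
corrected FIX); OURS sibling; the as-printed datum and the rev-2 `Eq4_31Datum_ours` are unchanged. [claim: Hu2025, status: under-review]
STATUS: candidate statement under adjudication (D-0012/D-0089); not asserted. -/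
structure Eq4_31Datum_terms [Fintype T] [DecidableEq 𝔗] (rel : T → 𝔗) (mono : T → (σ →₀ ℕ)) (sgn : T → ℤ)
    (Φ : Set 𝔗) extends Eq4_31Datum (k := k) rel mono sgn Φ where
  /-- every term `f_s`, `s ∈ S_F`, is a sub-sum of the monomials of `f` («the terms of `f` as in the expression of (4.31)»). -/
  fs_support : ∀ t : T, rel t = F → (fs t).support ⊆ f.support

variable (rel : T → 𝔗) (mono : T → (σ →₀ ℕ)) (sgn : T → ℤ)

/-- **Hu 2025, Def. 4.42 ‹4.41› — reading R1 over the TERMS-OF-`f` datum** (chunk p0030 l.28–33; PDF p.69): file b's `Def4_42` on the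
underlying as-printed datum of an `Eq4_31Datum_terms`. OURS sibling (lane-A reading 09:34:44Z). [claim: Hu2025, status: under-review]
STATUS: candidate statement under adjudication (D-0012/D-0089); not asserted. -/
def Def4_42_terms [Fintype T] [DecidableEq 𝔗] {Φ : Set 𝔗} (D : Eq4_31Datum_terms (k := k) rel mono sgn Φ) : Prop :=
  Def4_42 (k := k) rel mono sgn D.toEq4_31Datum

/-- **Hu 2025, Def. 4.42 ‹4.41› — reading R2 («co-prime, modulo `ker^{mh} φ_{[k]}`») over the TERMS-OF-`f` datum** (chunk p0030
l.31–32; PDF p.69). OURS sibling. [claim: Hu2025, status: under-review]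
STATUS: candidate statement under adjudication (D-0012/D-0089); not asserted. -/
def Def4_42_R2_terms [Fintype T] [DecidableEq 𝔗] {Φ : Set 𝔗} (D : Eq4_31Datum_terms (k := k) rel mono sgn Φ) : Prop :=
  Def4_42_R2 (k := k) rel mono sgn D.toEq4_31Datum

/-- **Hu 2025, Def. 4.42, the set `𝓕^{ϖϱ}_{[k]}` — over the TERMS-OF-`f` datum** (chunk p0030 l.35–36; PDF p.69): the `f` of the
terms-of-`f` (4.31)-data satisfying `Def4_42` (reading R1). OURS sibling of `varpiRhoRels` / `varpiRhoRels_ours`.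
[claim: Hu2025, status: under-review]
STATUS: candidate statement under adjudication (D-0012/D-0089); not asserted. -/
def varpiRhoRels_terms [Fintype T] [DecidableEq 𝔗] (Φ : Set 𝔗) : Set (ModelRing σ T k) :=
  {f | ∃ D : Eq4_31Datum_terms (k := k) rel mono sgn Φ, D.f = f ∧ Def4_42 (k := k) rel mono sgn D.toEq4_31Datum}

/-- **Hu 2025, Prop. 4.44 ‹4.43› — over the TERMS-OF-`f` datum** (chunk p0030 l.50–65; PDF p.70), verbatim claim: «… following the
notation above, we have `x_{(u_t,v_t)} f_s − x_{(u_s,v_s)} f_t ∈ ker^{mh} φ_{[k]}` for all `s, t ∈ S_F`.» — for every terms-of-`f`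
(4.31)-datum that is a ϖϱ-Plücker relation (reading R1). OURS sibling (lane-A reading 09:34:44Z); file b's `Prop4_44` and the rev-1/2
`Prop4_44_ours` / `Prop4_44_oursD` are unchanged. [claim: Hu2025, status: under-review]
STATUS: candidate statement under adjudication (D-0012/D-0089); not asserted. -/
def Prop4_44_terms [Fintype T] [DecidableEq 𝔗] (Φ : Set 𝔗) : Prop :=
  ∀ D : Eq4_31Datum_terms (k := k) rel mono sgn Φ, Def4_42 (k := k) rel mono sgn D.toEq4_31Datum →
    ∀ s t : T, rel s = D.F → rel t = D.F →
      rhoVar (k := k) (σ := σ) t * D.fs s - rhoVar (k := k) (σ := σ) s * D.fs t ∈ kerMH (k := k) rel mono Φ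

end Eq431Terms

end Literature.AlgebraicGeometry.Hu2025.Statements.S04ModelV

end
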